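import Summits.ResolutionOfSingularities.ResolutionOfSingularities.Theorems.EquisingularLiftEquisingularLiftNatNDChartPlays
import Mathlib.LinearAlgebra.Matrix.NonsingularInverse
import HarnessLib

/-!
# [OURS · L1 W4.5(b) · EL♮(3) · ND-K5 (B4α0) support 1/3] FAN-GAME BASICS FOR THE DRIVER: the cones of a star, `Bad` faces have two rays,
# convenience forces the first move, smooth cones have natural non-zero rays and integral DUAL vectors

OURS · L1 W4.5(b) · EL♮(3) stmt-ResolutionOfSingularities-20148 · counted 0 · AI-written (res-L1-w45b-iso-w3 g0, WIDTH TABLE D1′ row iso-w3 (2/2),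
desk res-L1-w45b-plan-1 g21 2026-08-28T14:40:28Z), weaker than expert review; nothing of [Hironaka2017] asserted; no statement of the manuscript.
Sorry-free, standard axioms, DEF-FREE, no instance, no notation. `--supports stmt-ResolutionOfSingularities-20148 --as helper`: support module toward the
registered 4th CHILD stub `stub_elnat_three_isolated_newtonNondegenerate` through the ND-K5 brick **(B4α0) `playFacts : ND.PlayFacts n`** of SPEC v9/v10
`Cruxes/EquisingularLiftNatThree/NewtonNondegenerateRungK5.lean` §13.14 (res-L1-w45b-idea-1 ROUND 12): the COMBINATORIAL DRIVER of the toric model round.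
Dim-3 char-p resolution is a theorem in print (Cossart–Piltant 2008/2009); everything here is OUR kernel-own bookkeeping of the local fan game of
`…NatResidueHypDefsND` (p625534: `Ray`, `pair`, `Bad`, `star`, `Reach`, `Won`, `e`, `orthantFan`, `IsConvenientTable`) and `…NatNDChartPlays`
(`IsSmoothCone`, `zMat`, `rayOf`, `isSmoothCone_starCone`, `not_bad_coordinateFace`, `pair_e`).

CONTENTS (all PROVED): `mem_star_iff` (the maximal cones of `star F τ`), `star_singleton_eq`, `star_empty_eq`; `exists_ne_of_bad` (a `Bad` face of a
nonempty table has two distinct rays), `bad_frame_of_ne` (on a convenient table with two distinct indices the full frame IS `Bad`),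
`eq_frame_of_bad_subset_frame` / `exists_not_mem_range_e_of_bad` (a `Bad` face made of frame rays is the whole frame — so the FIRST move of a play is
the full-frame star, and a `Bad` face of a cone not containing the frame has a NON-FRAME ray); `ray_nonneg_of_isSmoothCone`, `ray_ne_zero_of_isSmoothCone`,
`one_le_sum_ray_of_isSmoothCone`, `sum_ne_e_of_isSmoothCone` (the new ray `Σ τ` of a legal star is never a frame ray); `dotProduct_finset_sum`;
`exists_dual_of_isSmoothCone` (for each ray `t` of a smooth cone an integral functional `t*` with `t*·t = 1`, `t*·ρ = 0` on the other rays — a column of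
the inverse of the unimodular chart matrix, `Matrix.mul_nonsing_inv`), `sum_dual_eq_one`.  Used by `…NatNDFanSeparation` (2/3) and `…NatNDPlayFacts` (3/3).
-/

noncomputable section

set_option linter.dupNamespace false

open Matrix

namespace Summit.ResolutionOfSingularities.ResolutionOfSingularities.Cruxes.EquisingularLiftNat.Sections.ND

open Summit.ResolutionOfSingularities.ResolutionOfSingularities.Cruxes.EquisingularLiftNat.Sections

variable {n : ℕ}

/-! ### B. The star subdivision: membership -/

/-- The maximal cones of `star F τ`: the old cones not containing `τ`, and for each old cone `σ ⊇ τ` and each `t ∈ τ` the cone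
`insert (Σ τ) (σ.erase t)`. [OURS · L1 W4.5b · (B4α0) plumbing] -/
theorem mem_star_iff (F : Finset (Finset (Ray n))) (τ γ : Finset (Ray n)) :
    γ ∈ star F τ ↔ (γ ∈ F ∧ ¬ τ ⊆ γ) ∨ ∃ σ ∈ F, τ ⊆ σ ∧ ∃ t ∈ τ, γ = insert (∑ ρ ∈ τ, ρ) (σ.erase t) := by
  classical
  simp only [star, Finset.mem_union, Finset.mem_filter, Finset.mem_biUnion, Finset.mem_image]
  constructor
  · rintro (⟨h1, h2⟩ | ⟨σ, ⟨hσ, hτσ⟩, t, ht, h⟩)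
    · exact Or.inl ⟨h1, h2⟩
    · exact Or.inr ⟨σ, hσ, hτσ, t, ht, h.symm⟩
  · rintro (⟨h1, h2⟩ | ⟨σ, hσ, hτσ, t, ht, h⟩)
    · exact Or.inl ⟨h1, h2⟩
    · exact Or.inr ⟨σ, ⟨hσ, hτσ⟩, t, ht, h.symm⟩

/-- The star at a singleton changes nothing (`insert ρ (σ.erase ρ) = σ`). [OURS · L1 W4.5b] -/
theorem star_singleton_eq (F : Finset (Finset (Ray n))) (ρ : Ray n) : star F {ρ} = F := by
  classical
  ext γ
  rw [mem_star_iff]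
  constructor
  · rintro (⟨h1, -⟩ | ⟨σ, hσ, hρσ, t, ht, rfl⟩)
    · exact h1
    · rw [Finset.mem_singleton] at ht
      subst ht
      rw [Finset.sum_singleton, Finset.insert_erase (Finset.singleton_subset_iff.1 hρσ)]
      exact hσ
  · intro hγ
    by_cases h : {ρ} ⊆ γ
    · refine Or.inr ⟨γ, hγ, h, ρ, Finset.mem_singleton_self ρ, ?_⟩
      rw [Finset.sum_singleton, Finset.insert_erase (Finset.singleton_subset_iff.1 h)]
    · exact Or.inl ⟨hγ, h⟩

/-- The star at the empty face of a fan all of whose cones contain it (all of them) has NO cones. [OURS · L1 W4.5b] -/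
theorem star_empty_eq (F : Finset (Finset (Ray n))) : star F ∅ = ∅ := by
  classical
  ext γ
  rw [mem_star_iff]
  simp

/-! ### C. `Bad` faces have two distinct rays; consequences of CONVENIENCE -/

/-- A `Bad` face of a nonempty table has at least two distinct rays (the empty face and singletons always have a simultaneous minimiser).
[OURS · L1 W4.5b] -/
theorem exists_ne_of_bad {V : Finset (Fin n → ℕ)} (hV : V.Nonempty) {τ : Finset (Ray n)} (hB : Bad V τ) :
    ∃ ρ₁ ∈ τ, ∃ ρ₂ ∈ τ, ρ₁ ≠ ρ₂ := by
  classical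
  by_contra hcon
  push Not at hcon
  apply hB
  rcases τ.eq_empty_or_nonempty with hτ | ⟨ρ, hρ⟩
  · obtain ⟨m, hm⟩ := hV
    exact ⟨m, hm, by simp [hτ]⟩
  · obtain ⟨m, hm, hmin⟩ := Finset.exists_min_image V (pair ρ) hV
    refine ⟨m, hm, fun ρ' hρ' m' hm' => ?_⟩
    rw [hcon ρ' hρ' ρ hρ]
    exact hmin m' hm'

/-- On a CONVENIENT table with `n ≥ 2` (two distinct indices) the full frame IS `Bad`: a simultaneous minimiser of all coordinates would be `0 ∈ V`.
[OURS · L1 W4.5b] -/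
theorem bad_frame_of_ne {V : Finset (Fin n → ℕ)} (hV : IsConvenientTable V) {i j : Fin n} (hij : i ≠ j) :
    Bad V (Finset.univ.image (e n)) := by
  classical
  obtain ⟨h0, hax⟩ := hV
  rintro ⟨m, hm, hmin⟩
  apply h0
  have hm0 : m = 0 := by
    funext l
    -- pick an index different from `l`
    have : ∃ i', i' ≠ l := by
      by_cases h : i = l
      · exact ⟨j, fun h' => hij (h.trans h'.symm)⟩
      · exact ⟨i, h⟩
    obtain ⟨i', hi'⟩ := this
    obtain ⟨v, hv, -, hv0⟩ := hax i'
    have h1 := hmin (e n l) (Finset.mem_image_of_mem _ (Finset.mem_univ l)) v hv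
    rw [pair_e, pair_e, hv0 l (Ne.symm hi')] at h1
    have h2 : 0 ≤ (m l : ℤ) := by exact_mod_cast Nat.zero_le _
    have h3 : (m l : ℤ) = 0 := le_antisymm (by exact_mod_cast h1) h2
    exact_mod_cast h3
  rw [← hm0]; exact hm

/-- A `Bad` set of FRAME rays on a convenient table is the whole frame (`not_bad_coordinateFace`). [OURS · L1 W4.5b] -/
theorem eq_frame_of_bad_subset_frame {V : Finset (Fin n → ℕ)} (hV : IsConvenientTable V) {τ : Finset (Ray n)}
    (hτ : τ ⊆ Finset.univ.image (e n)) (hB : Bad V τ) : τ = Finset.univ.image (e n) := by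
  classical
  set I : Finset (Fin n) := Finset.univ.filter (fun i => e n i ∈ τ) with hI
  have hτI : τ = I.image (e n) := by
    ext ρ
    constructor
    · intro hρ
      obtain ⟨i, -, rfl⟩ := Finset.mem_image.1 (hτ hρ)
      exact Finset.mem_image_of_mem _ (by rw [hI, Finset.mem_filter]; exact ⟨Finset.mem_univ _, hρ⟩)
    · intro hρ
      obtain ⟨i, hi, rfl⟩ := Finset.mem_image.1 hρ
      exact (Finset.mem_filter.1 hi).2
  by_cases hIu : I = Finset.univ
  · rw [hτI, hIu]
  · exfalso
    obtain ⟨j, -, hj⟩ := Finset.exists_mem_notMem_of_card_lt_card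
      (Finset.card_lt_card (Finset.ssubset_iff_subset_ne.2 ⟨Finset.subset_univ I, hIu⟩))
    rw [hτI] at hB
    exact not_bad_coordinateFace hV hj hB

/-- A `Bad` face of a cone NOT containing the whole frame has a NON-FRAME ray (convenient table). [OURS · L1 W4.5b] -/
theorem exists_not_mem_range_e_of_bad {V : Finset (Fin n → ℕ)} (hV : IsConvenientTable V) {σ τ : Finset (Ray n)}
    (hτσ : τ ⊆ σ) (hN : ¬ Finset.univ.image (e n) ⊆ σ) (hB : Bad V τ) : ∃ ρ ∈ τ, ρ ∉ Set.range (e n) := by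
  classical
  by_contra hcon
  push Not at hcon
  have hτ : τ ⊆ Finset.univ.image (e n) := by
    intro ρ hρ
    obtain ⟨i, hi⟩ := hcon ρ hρ
    exact Finset.mem_image.2 ⟨i, Finset.mem_univ _, hi⟩
  have := eq_frame_of_bad_subset_frame hV hτ hB
  subst this
  exact hN hτσ

/-! ### D. Smooth cones: natural non-zero rays and DUAL vectors -/

/-- Rays of a smooth cone have natural (non-negative) coordinates. [OURS · L1 W4.5b] -/
theorem ray_nonneg_of_isSmoothCone {σ : Finset (Ray n)} (hσ : IsSmoothCone σ) {ρ : Ray n} (hρ : ρ ∈ σ) (l : Fin n) : 0 ≤ ρ l := by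
  obtain ⟨B, rfl, -⟩ := hσ
  obtain ⟨i, -, rfl⟩ := Finset.mem_image.1 hρ
  show (0 : ℤ) ≤ ((B i l : ℕ) : ℤ)
  exact_mod_cast Nat.zero_le _

/-- Rays of a smooth cone are non-zero (a unimodular matrix has no zero row). [OURS · L1 W4.5b] -/
theorem ray_ne_zero_of_isSmoothCone {σ : Finset (Ray n)} (hσ : IsSmoothCone σ) {ρ : Ray n} (hρ : ρ ∈ σ) : ρ ≠ 0 := by
  obtain ⟨B, rfl, hB⟩ := hσ
  obtain ⟨i, -, rfl⟩ := Finset.mem_image.1 hρ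
  intro h
  have h0 : (zMat B).det = 0 := Matrix.det_eq_zero_of_row_eq_zero i (fun l => by
    have := congrFun h l
    simpa [zMat, rayOf] using this)
  rw [h0] at hB
  exact not_isUnit_zero hB

/-- The coordinate sum of a ray of a smooth cone is at least `1`. [OURS · L1 W4.5b] -/
theorem one_le_sum_ray_of_isSmoothCone {σ : Finset (Ray n)} (hσ : IsSmoothCone σ) {ρ : Ray n} (hρ : ρ ∈ σ) : 1 ≤ ∑ l, ρ l := by
  have hnn := ray_nonneg_of_isSmoothCone hσ hρ
  have hne := ray_ne_zero_of_isSmoothCone hσ hρ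
  obtain ⟨l, hl⟩ : ∃ l, ρ l ≠ 0 := by
    by_contra h
    push Not at h
    exact hne (funext h)
  have h1 : 1 ≤ ρ l := by have := hnn l; omega
  exact h1.trans (Finset.single_le_sum (fun l' _ => hnn l') (Finset.mem_univ l))

/-- **The new ray is never a frame ray**: the sum of a face with two distinct rays of a smooth cone has coordinate sum `≥ 2`. [OURS · L1 W4.5b] -/
theorem sum_ne_e_of_isSmoothCone {σ τ : Finset (Ray n)} (hσ : IsSmoothCone σ) (hτσ : τ ⊆ σ)
    (h2 : ∃ ρ₁ ∈ τ, ∃ ρ₂ ∈ τ, ρ₁ ≠ ρ₂) (j : Fin n) : (∑ ρ ∈ τ, ρ) ≠ e n j := by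
  classical
  intro h
  have hsum : ∑ l, (∑ ρ ∈ τ, ρ) l = 1 := by
    rw [h]
    simp [e, Pi.single_apply]
  have hge : (2 : ℤ) ≤ ∑ l, (∑ ρ ∈ τ, ρ) l := by
    obtain ⟨ρ₁, h₁, ρ₂, h₂, hne⟩ := h2
    have hcard : 2 ≤ τ.card := Finset.one_lt_card.2 ⟨ρ₁, h₁, ρ₂, h₂, hne⟩
    calc (2 : ℤ) ≤ (τ.card : ℤ) := by exact_mod_cast hcard
      _ = ∑ ρ ∈ τ, (1 : ℤ) := by simp
      _ ≤ ∑ ρ ∈ τ, ∑ l, ρ l := Finset.sum_le_sum fun ρ hρ => one_le_sum_ray_of_isSmoothCone hσ (hτσ hρ)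
      _ = ∑ l, (∑ ρ ∈ τ, ρ) l := by rw [Finset.sum_comm]; simp [Finset.sum_apply]
  omega

/-- Dot product with a finite sum of rays. [OURS · L1 W4.5b · small print] -/
theorem dotProduct_finset_sum (u : Ray n) (τ : Finset (Ray n)) : u ⬝ᵥ (∑ ρ ∈ τ, ρ) = ∑ ρ ∈ τ, u ⬝ᵥ ρ := by
  classical
  unfold dotProduct
  rw [Finset.sum_comm]
  refine Finset.sum_congr rfl fun l _ => ?_
  rw [Finset.sum_apply, Finset.mul_sum]

/-- **DUAL VECTORS of a smooth cone**: for every ray `t` of a smooth cone `σ` there is an integral functional which is `1` on `t` and `0` on the other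
rays of `σ` (a column of the inverse of the unimodular chart matrix). [OURS · L1 W4.5b] -/
theorem exists_dual_of_isSmoothCone {σ : Finset (Ray n)} (hσ : IsSmoothCone σ) {t : Ray n} (ht : t ∈ σ) :
    ∃ w : Ray n, w ⬝ᵥ t = 1 ∧ ∀ ρ ∈ σ, ρ ≠ t → w ⬝ᵥ ρ = 0 := by
  classical
  obtain ⟨B, rfl, hB⟩ := hσ
  obtain ⟨i, -, rfl⟩ := Finset.mem_image.1 ht
  have key : ∀ j : Fin n, (fun l => (zMat B)⁻¹ l i) ⬝ᵥ rayOf (B j) = if j = i then 1 else 0 := by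
    intro j
    have h := congrFun (congrFun (Matrix.mul_nonsing_inv (zMat B) hB) j) i
    rw [Matrix.mul_apply, Matrix.one_apply] at h
    rw [← h]
    unfold dotProduct
    refine Finset.sum_congr rfl fun l _ => ?_
    rw [mul_comm]
    rfl
  refine ⟨fun l => (zMat B)⁻¹ l i, by rw [key, if_pos rfl], fun ρ hρ hne => ?_⟩
  obtain ⟨j, -, rfl⟩ := Finset.mem_image.1 hρ
  rw [key, if_neg]
  rintro rfl
  exact hne rfl

/-- Sum of a dual vector over a face containing its ray. [OURS · L1 W4.5b · small print] -/
theorem sum_dual_eq_one {σ τ : Finset (Ray n)} (hτσ : τ ⊆ σ) {t : Ray n} (ht : t ∈ τ) {w : Ray n} (hw1 : w ⬝ᵥ t = 1)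
    (hw0 : ∀ ρ ∈ σ, ρ ≠ t → w ⬝ᵥ ρ = 0) : ∑ ρ ∈ τ, w ⬝ᵥ ρ = 1 := by
  classical
  rw [← Finset.add_sum_erase τ _ ht, hw1, Finset.sum_eq_zero fun ρ hρ => ?_]
  · ring
  · exact hw0 ρ (hτσ (Finset.mem_of_mem_erase hρ)) (Finset.ne_of_mem_erase hρ)


end Summit.ResolutionOfSingularities.ResolutionOfSingularities.Cruxes.EquisingularLiftNat.Sections.ND

end
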